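import Summits.QuantumFields.YangMills.Theorems.FluctuationComparisonRegPrIntLS2BetaComposedDilutionKernel
import Summits.QuantumFields.YangMills.Theorems.FluctuationComparisonRegPrIntLS2BetaTorusCellClasses
import Summits.QuantumFields.YangMills.Theorems.FluctuationComparisonRegPrIntLS2BetaComposedKernelDock
import HarnessLib

/-!
# S2β · (SCT″-c)₁ — «THE CURL-KERNEL KNIT, TORUS EDITION»: on one torus tower `T^{(0)} ⊃ T^{(1)} ⊃ … ⊃ T^{(m)}` of a generic `P : Params`, for every family of plaquette sizes obeying
# CURL-AVG's lower-left rows with sources, the weighted sum over generations of the READ-CELL MAXIMA of the squared sizes is at most TWICE the K-UNIFORM kernel budget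
# `Λ★·κ²·ν·C_b·Σ_z ρ₀(z)²` plus TWICE the composed-source term — the three letters ✓`exists_composedKernel` (K0)–(K5), ✓`…TorusCellClasses` (cells, boxes, cover) and
# ✓`dock_of_kernel` assembled by `exact`, nothing else

Cell `ym3-torus` (YM ladder rung R3 = continuum `SU(2)` Yang–Mills on the three-torus at fixed lattice data — a RUNG: NOT d = 4, NOT infinite volume, NOT a mass gap,
NOT Clay).  Width seat «width 16» `ym3-torus-px16` (gen 23), S2β pairing-letter lane holder by lineage; crux `stmt-QuantumFields-20520`
(`…Theses.UnitScaleTilt.FluctuationComparisonRegPrIntL`), LINE g18-1 S2β.  `--kind proof --supports stmt-QuantumFields-20520 --as helper`, count-neutral, DEFINITION-FREE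
(0 `def`, 0 `instance`, 0 `notation`, 0 `sorry`; ONE decl-local `set_option maxHeartbeats 400000 in` on the main theorem, README form).

WHY.  ✓p831146 FILE 3′ `supTower_of_liftLadder₃'` wants `hSCT₁ : Σ_{t<K−J} L^t·c₁ t ≤ C₁·e^{c_cΣθ}·purse` for the CURL part `c₁` of the lift-ladder recursion; the honest `c₁ t`
is a constant times `Σ_B max_{q ∈ READ-cells_t(B)} ρ_{u(t)}(q)²` (relative plaquette sizes of the descended pair at tower level `u(t) = J+t+1`, read under the two top blocks of `B`,
thickened).  By (K5) `ρ_u ≤ K_n ρ_K + (composed sources)`, `n = K − u`; the kernel part is K-UNIFORM by the dock over (★); the source part is the (M, V)-profile's (HAZARD «SRC-θ»: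
closable under the (BKG) decay of the minimiser's tower, ARCHITECT RULING (ST″) 2026-08-31T18:56Z).  THIS FILE is the TORUS edition of that knit: one `P`, internal levels
`0 … m` (`m ≤ m_P + K_P`), an ABSTRACT index type `ι` of «top bonds» with endpoint cells `ends i ⊆ T^{(m)}` (`#{i : e ∈ ends i} ≤ η`) and a generic read thickness `θ`; the T³-family
edition (`P := F.P K`, `m := K − J`, `ι := PBond (F.P J) 0`, `ends B := {σB.src, σB.tgt}` cast by `siteShift`, `ρ_i` := px13 g27's ✓`…CoarseCurlRowsLL` tower of the descended pair,
weights `Λ n := Cst·L^{K−J−1−n}`) is a cast away and is the next file.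

WHAT IS PROVED (sorry-free).
★★★ `weighted_readMax_sq_le` (the ONLY declaration) — DATA: `P` with `4 ≤ L^d`, orientation `μ ≠ ν`, top generation `m ≤ m_P + K_P`, `ends`, `θ`, `η`; sizes `ρ ≥ 0` and sources `src` with the rows
  `ρ_{i+1}(y′) ≤ |I|⁻¹·Σ_a ρ_i(base a y′) + src_{i+1}(y′)` (`i < m`); local source majorants `τ n Y j` (`src_j(blockIter j x) ≤ τ n Y j` whenever `|rel Y (blockIter n x)|_κ ≤ 2`,
  `1 ≤ j ≤ n ≤ m`); weights `Λ n ≥ 0` with the FLATNESS `Λ n·(m_P^n)²·(L^d)^n ≤ Λ★` (`m_P = (d!)²L²∕|I| = L^{2−d}`; at `d = 3`, `Λ n = L^{k−1−n}`: `Λ★ = L^{k−1}`); any SELECTION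
  `sel n i ∈ T^{(n)}` of read cells (`∃ z, blockIter m z ∈ ends i ∧ |rel (blockIter n z) (sel n i)|_κ ≤ θ`).  CONCLUSION:
      `Σ_{n≤m} Λ n·Σ_i ρ_n(sel n i)² ≤ 2·Λ★·(5^d)²·((2θ+5)^d·η)·(2(L^d−1)∕(L^d−3))·Σ_z ρ₀(z)² + 2·Σ_{n≤m} Λ n·Σ_i (Σ_{j=1}^{n} (L²)^{n−j}·τ n (sel n i) j)²`.
  PROOF = (K5) at each selected cell (top source via the cell itself) + `(A+B)² ≤ 2A²+2B²` + ✓`dock_of_kernel` with `X := T^{(0)}`, `b := L^d`, px13's `cl`∕`nb`∕`read`∕`top`∕`R`,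
  `K n x q := K_n (blockIter n x) q`, `sel′ n i := embIter n (sel n i)` (lit ✓`blockIter_embIter`).
A bound uniform over selections IS the bound for the read-cell maxima (`Finset.exists_mem_eq_sup'`), which is how `c₁` will be defined.

HONEST SCOPE.  Assembly of landed letters by name; nothing of Bałaban's analysis is asserted or proved ([Balaban1985Averaging] Prop. 4 (128)–(135) pp.37–38: the printed sup recursion
this bookkeeping serves); the source term is NOT bounded here (HAZARD «SRC-θ», (BKG)); (SCT″-c)₁₂₃, (LIFT-LAD″), (TOP-LAD″), (ST″), (ST), LOC″, LOC, AVG₂♭-ax_q, (D-ax), h3 HYPOTHESES;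
GAP♯∘ (`stub_uniformFibreGapOrbit`, registry untouched, 0∕5), S2β, crux 20520, 19936, 19200 and `YM3TorusSU2` are NOT proved; no registered stub is closed; rung R3 = SU(2) YM₃ on
T³ — NOT d = 4, NOT infinite volume, NOT a mass gap, NOT Clay; the Yang–Mills mass gap is NOT proved.
References: T. Bałaban, CMP **98** (1985) 17–51 [Balaban1985Averaging]; CMP **109** (1987) 249–301 [Balaban1987RG1].
-/

set_option autoImplicit false

noncomputable section

namespace Summit.QuantumFields.YangMills.Theorems.FluctuationComparisonRegPrIntLS2BetaCurlKernelKnitTorus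

open scoped BigOperators
open Finset
open Literature.MathematicalPhysics.QuantumFieldTheory.Balaban1983to89
open Literature.MathematicalPhysics.QuantumFieldTheory.Balaban1983to89.T4Continuum
open Literature.MathematicalPhysics.QuantumFieldTheory.Balaban1983to89.BlockAveraging (Idx)
open Literature.MathematicalPhysics.QuantumFieldTheory.Balaban1983to89.B10Eq47AxialChi (shiftN)
open B10Eq27TorusAxialLog (rel rel_self)
open B14.Eq22Determines (blockIter)
open B15DeterminingSets (embIter)
open B15Eq177GaugeInvariance (blockIter_embIter)
open Summit.QuantumFields.YangMills.Theorems.FluctuationComparisonRegPrIntLS2BetaComposedDilutionKernel (exists_composedKernel)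
open Summit.QuantumFields.YangMills.Theorems.FluctuationComparisonRegPrIntLS2BetaTorusCellClasses
open Summit.QuantumFields.YangMills.Theorems.FluctuationComparisonRegPrIntLS2BetaComposedKernelDock (dock_of_kernel)

variable {P : Params}

set_option maxHeartbeats 400000 in
/-- ★★★ **THE CURL-KERNEL KNIT, TORUS EDITION** (selection form): for sizes `ρ ≥ 0` obeying CURL-AVG's lower-left rows with sources `src`, local source majorants `τ`, FLAT weights
`Λ n·(m_P^n)²·(L^d)^n ≤ Λ★`, and any selection of read cells `sel n i` (within `θ` of the gen-`n` ancestor of a site blocking into `ends i`),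
    `Σ_{n≤m} Λ n·Σ_i ρ_n(sel n i)² ≤ 2·Λ★·(5^d)²·((2θ+5)^d·η)·(2(L^d−1)∕(L^d−3))·Σ_z ρ₀(z)² + 2·Σ_{n≤m} Λ n·Σ_i (Σ_{j=1}^{n} (L²)^{n−j}·τ n (sel n i) j)²`.
[cite: Balaban1985Averaging, Prop. 4 (128)-(135) pp.37-38, (19)-(20) p.21; Balaban1987RG1, (0.1)-(0.4) pp.251-253, (0.11) p.253] -/
theorem weighted_readMax_sq_le (hb : 4 ≤ P.L ^ P.d) {μ ν : Fin P.d} (hμν : μ ≠ ν) {m : ℕ} (hm : m ≤ P.m + P.K)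
    {ι : Type*} [Fintype ι] (ends : ι → Finset (Site P m)) (θ η : ℕ)
    (hends : ∀ e : Site P m, (univ.filter (fun i : ι => e ∈ ends i)).card ≤ η)
    (ρ src : (i : ℕ) → Site P i → ℝ) (hρ : ∀ i x, 0 ≤ ρ i x)
    (hrow : ∀ i, i < m → ∀ y' : Site P (i + 1),
        ρ (i + 1) y' ≤ (Fintype.card (Idx P) : ℝ)⁻¹ *
            ∑ a ∈ (Finset.univ : Finset (Idx P)) ×ˢ (Finset.range P.L ×ˢ Finset.range P.L), ρ i (shiftN (shiftN (Site.blockSite y' a.1.1) μ a.2.1) ν a.2.2) +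
          src (i + 1) y')
    (τ : (n : ℕ) → Site P n → ℕ → ℝ)
    (hτ : ∀ n, n ≤ m → ∀ (Y : Site P n) (j : ℕ), 1 ≤ j → j ≤ n → ∀ x : Site P 0, (∀ κ, (rel Y (blockIter n x) κ).natAbs ≤ 2) → src j (blockIter j x) ≤ τ n Y j)
    (Λ : ℕ → ℝ) (Λstar : ℝ) (hΛ : ∀ n, 0 ≤ Λ n)
    (hflat : ∀ n ≤ m, Λ n * (((((Fintype.card (Equiv.Perm (Fin P.d))) ^ 2 * P.L ^ 2 : ℕ) : ℝ) / (Fintype.card (Idx P) : ℝ)) ^ n) ^ 2 *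
        (((P.L ^ P.d : ℕ)) : ℝ) ^ n ≤ Λstar)
    (sel : (n : ℕ) → ι → Site P n)
    (hsel : ∀ n, n ≤ m → ∀ i, ∃ z : Site P 0, blockIter m z ∈ ends i ∧ ∀ κ, (rel (blockIter n z) (sel n i) κ).natAbs ≤ θ) :
    ∑ n ∈ Finset.range (m + 1), Λ n * ∑ i, ρ n (sel n i) ^ 2 ≤
      2 * (Λstar * ((5 ^ P.d : ℕ) : ℝ) ^ 2 * (((2 * (θ + 2) + 1) ^ P.d * η : ℕ) : ℝ) *
            (2 * ((((P.L ^ P.d : ℕ)) : ℝ) - 1) / ((((P.L ^ P.d : ℕ)) : ℝ) - 3)) * ∑ z : Site P 0, ρ 0 z ^ 2) +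
        2 * ∑ n ∈ Finset.range (m + 1), Λ n * ∑ i, (∑ j ∈ Finset.Icc 1 n, ((P.L : ℝ) ^ 2) ^ (n - j) * τ n (sel n i) j) ^ 2 := by
  classical
  -- `(A + B)² ≤ 2A² + 2B²` for a nonnegative quantity below `A + B` (inlined; a public twin lives in another summit tree)
  have sq_le : ∀ {x A B : ℝ}, 0 ≤ x → x ≤ A + B → x ^ 2 ≤ 2 * A ^ 2 + 2 * B ^ 2 := by
    intro x A B hx h
    have h1 : x ^ 2 ≤ (A + B) ^ 2 := pow_le_pow_left₀ hx h 2
    nlinarith [sq_nonneg (A - B)]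
  -- the composed kernels, one per generation in the standing range
  have hex := fun (n : ℕ) (hn : n ≤ P.m + P.K) => exists_composedKernel (P := P) hμν n hn
  choose Kf hK0 hK1 hK2 hK3 hK4 hK5 using hex
  -- abbreviations
  set mP : ℝ := ((((Fintype.card (Equiv.Perm (Fin P.d))) ^ 2 * P.L ^ 2 : ℕ) : ℝ) / (Fintype.card (Idx P) : ℝ)) with hmP
  have hmP0 : 0 ≤ mP := by rw [hmP]; positivity
  -- the engine's kernel, indexed by finest representatives
  set Ke : ℕ → Site P 0 → Site P 0 → ℝ := fun n x q => if hn : n ≤ P.m + P.K then Kf n hn (blockIter n x) q else 0 with hKe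
  have hKe_of_le : ∀ {n : ℕ} (hn : n ≤ P.m + P.K) (x q : Site P 0), Ke n x q = Kf n hn (blockIter n x) q := by
    intro n hn x q; simp only [hKe, dif_pos hn]
  -- STEP 1: (K5) + squaring at every selected cell
  have hcell : ∀ n ∈ Finset.range (m + 1), ∀ i,
      ρ n (sel n i) ^ 2 ≤ 2 * (∑ q, Ke n (embIter n (sel n i)) q * ρ 0 q) ^ 2 + 2 * (∑ j ∈ Finset.Icc 1 n, ((P.L : ℝ) ^ 2) ^ (n - j) * τ n (sel n i) j) ^ 2 := by
    intro n hn i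
    rw [Finset.mem_range] at hn
    have hnm : n ≤ m := by omega
    have hnP : n ≤ P.m + P.K := hnm.trans hm
    have hdom := hK5 n hnP ρ src (fun i hi y' => hrow i (by omega) y') (sel n i) (fun j => τ n (sel n i) j)
      (fun j hj1 hjn x hx => hτ n hnm (sel n i) j hj1 hjn x hx)
    have hrepr : ∑ q, Ke n (embIter n (sel n i)) q * ρ 0 q = ∑ z, Kf n hnP (sel n i) z * ρ 0 z := by
      refine Finset.sum_congr rfl fun q _ => ?_
      rw [hKe_of_le hnP, blockIter_embIter n hnP]
    rw [hrepr]
    exact sq_le (hρ n _) hdom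
  -- STEP 2: the dock (kernel part), with px13 g27's class data and read cover
  have hdock := dock_of_kernel (X := Site P 0) (ι := ι) (P.L ^ P.d) hb
    (fun n x => univ.filter (fun x' : Site P 0 => blockIter (min n (P.m + P.K)) x' = blockIter (min n (P.m + P.K)) x))
    (fun n x => mem_cl_self n x) (fun n x y hy => cl_eq_of_mem n x y hy) (fun n x => cl_subset_succ n x) (fun n x => card_cl_le n x)
    (ρ 0) (hρ 0) m
    (fun n i => (univ.filter (fun Y : Site P n => ∃ z : Site P 0, blockIter m z ∈ ends i ∧ ∀ κ, (rel (blockIter n z) Y κ).natAbs ≤ θ)).image (embIter n))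
    Ke (fun n => mP ^ n)
    (fun n y => (univ.filter (fun c : Site P n => ∀ κ, (rel (blockIter n y) c κ).natAbs ≤ 2)).image (embIter n)) (5 ^ P.d)
    (fun n => pow_nonneg hmP0 n) (fun n y => card_nb_le n y)
    (fun n x q => by
      by_cases hn : n ≤ P.m + P.K
      · rw [hKe_of_le hn]; exact hK0 n hn _ _
      · simp only [hKe, dif_neg hn]; exact le_rfl)
    (fun n x q => by
      by_cases hn : n ≤ P.m + P.K
      · rw [hKe_of_le hn]; exact hK1 n hn _ _
      · simp only [hKe, dif_neg hn]; exact pow_nonneg hmP0 n)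
    (fun n x q hne => by
      by_cases hn : n ≤ P.m + P.K
      · rw [hKe_of_le hn] at hne
        exact exists_mem_nb_of_rel_le_two hn x q (hK4 n hn _ _ hne)
      · exact absurd (by simp only [hKe, dif_neg hn]) hne)
    (fun i => (univ.filter (fun c : Site P m => ∃ e ∈ ends i, ∀ κ, (rel e c κ).natAbs ≤ θ + 2)).image (embIter m))
    ((univ : Finset (Site P m)).image (embIter m)) ((2 * (θ + 2) + 1) ^ P.d * η)
    (read_cover' hm ends θ) (fun i => top_subset_R ends θ i) (pairwiseDisjoint_cl_image_embIter hm univ)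
    (fun r hr => by
      rw [Finset.mem_image] at hr
      obtain ⟨c₀, -, rfl⟩ := hr
      exact card_filter_mem_top_le hm ends θ η hends c₀)
    Λ Λstar hΛ hflat
    (fun n i => embIter n (sel n i))
    (fun n hnm i => by
      obtain ⟨z, hz, hrel⟩ := hsel n hnm i
      exact Finset.mem_image_of_mem _ (by rw [Finset.mem_filter]; exact ⟨Finset.mem_univ _, z, hz, hrel⟩))
  -- STEP 3: assemble
  have hsum : ∑ n ∈ Finset.range (m + 1), Λ n * ∑ i, ρ n (sel n i) ^ 2 ≤
      ∑ n ∈ Finset.range (m + 1), Λ n * ∑ i, (2 * (∑ q, Ke n (embIter n (sel n i)) q * ρ 0 q) ^ 2 +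
        2 * (∑ j ∈ Finset.Icc 1 n, ((P.L : ℝ) ^ 2) ^ (n - j) * τ n (sel n i) j) ^ 2) :=
    Finset.sum_le_sum fun n hn => mul_le_mul_of_nonneg_left (Finset.sum_le_sum fun i _ => hcell n hn i) (hΛ n)
  have hstep : ∀ n ∈ Finset.range (m + 1),
      Λ n * ∑ i, (2 * (∑ q, Ke n (embIter n (sel n i)) q * ρ 0 q) ^ 2 +
        2 * (∑ j ∈ Finset.Icc 1 n, ((P.L : ℝ) ^ 2) ^ (n - j) * τ n (sel n i) j) ^ 2) =
      2 * (Λ n * ∑ i, (∑ q, Ke n (embIter n (sel n i)) q * ρ 0 q) ^ 2) +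
        2 * (Λ n * ∑ i, (∑ j ∈ Finset.Icc 1 n, ((P.L : ℝ) ^ 2) ^ (n - j) * τ n (sel n i) j) ^ 2) := by
    intro n _
    rw [Finset.sum_add_distrib, ← Finset.mul_sum, ← Finset.mul_sum]
    ring
  have h2 : (0 : ℝ) ≤ 2 := by norm_num
  calc ∑ n ∈ Finset.range (m + 1), Λ n * ∑ i, ρ n (sel n i) ^ 2
      ≤ _ := hsum
    _ = ∑ n ∈ Finset.range (m + 1), (2 * (Λ n * ∑ i, (∑ q, Ke n (embIter n (sel n i)) q * ρ 0 q) ^ 2) +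
        2 * (Λ n * ∑ i, (∑ j ∈ Finset.Icc 1 n, ((P.L : ℝ) ^ 2) ^ (n - j) * τ n (sel n i) j) ^ 2)) := Finset.sum_congr rfl hstep
    _ = 2 * (∑ n ∈ Finset.range (m + 1), Λ n * ∑ i, (∑ q, Ke n (embIter n (sel n i)) q * ρ 0 q) ^ 2) +
        2 * ∑ n ∈ Finset.range (m + 1), Λ n * ∑ i, (∑ j ∈ Finset.Icc 1 n, ((P.L : ℝ) ^ 2) ^ (n - j) * τ n (sel n i) j) ^ 2 := by
          rw [Finset.sum_add_distrib, ← Finset.mul_sum, ← Finset.mul_sum]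
    _ ≤ _ := add_le_add (mul_le_mul_of_nonneg_left hdock h2) le_rfl

end Summit.QuantumFields.YangMills.Theorems.FluctuationComparisonRegPrIntLS2BetaCurlKernelKnitTorus

end
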